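import Literature.MathematicalPhysics.QuantumFieldTheory.Balaban1983to89.B3PropagatorChains433

/-!
# `Balaban1983to89.B3PropagatorChains433Model` — T. Bałaban, *(Higgs)₂,₃ quantum fields in a finite volume. III. Renormalization*,
Commun. Math. Phys. **88** (1983) 411–445 [Balaban1983Higgs3]: p. 433, the CHAINS OF PROPAGATORS as explicit graphs of the model
`B3Cor23Concrete.Graph` and their SUB-CHAINS — *"For such chains, every subgraph has positive degree or contains (2.4)"* (file 2 of
2; file 1 `…B3PropagatorChains433` = the degree of every graph with the incidence of a chain)

statement-level skeleton of published theorems with citation tags; proofs where landed; nothing here is a claim about the Yang–Mills mass gap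

PDF held: `paper:balaban1983-higgs-2-3-quantum-fields-finite-volume` (journal page = PDF page + 410); p. 433 [PDF 23] read on the
OCR text and on the ×2 render `run/shared/lean/pub/pub-balaban/b2b-balaban-ref1/pages/1983-cmp88-higgs23-III/1983-cmp88-higgs23-III-p023-x2.png`.
CITATION HEADER (lean-in-tree rule).  lit-balaban TYPED SKELETON (HOME `run/shared/lean/pub/lit-balaban/`), Phase 2, seat p18
(gen 6), unit `lit-balaban-p18`: SKELETON row **B3.Txt@433** (*"p. 433, the reduction steps"*, owner r15, referee ref-4).  p. 433
[PDF 23], verbatim: *"If a class does not contain any old vertex, then it is created by an expansion of a propagator G_k(□, B̃)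
and it consists of one graph having the form of a chain of propagators G_k(□, B₀), with vertices of the form (1.8)–(1.11) and
(1.13)–(1.15) with external vector field B′ only. For such chains, every subgraph has positive degree or contains (2.4), and the
estimate (3.2) for them is a consequence of Proposition 2.1."*

THE MODEL OF A CHAIN (`ChainData`, `ChainData.graph`).  A chain of propagators with `nL ≥ 1` lines: vertices `0, 1, …, nL` of
the form (1.8)–(1.11) (file 1's `isChainVertex`), admissible for the order n̄; consecutive vertices `i`, `i+1` joined by ONE
scalar line (the propagator G_k(□, B₀)) from the FORWARD φ′-leg of `i` to the BACKWARD φ′-leg of `i+1`; the backward leg of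
vertex `0`, the forward leg of vertex `nL` and every vector leg external (*"with external vector field B′ only"*: the B′-legs are
external-field legs `n′`); for each vertex the datum `fwd i` says whether its leg 0 — the differentiated leg `(D^η φ′)(b)` of
(1.8)/(1.9) — is the forward one.  A SUBGRAPH of a chain (connected, with at least one line — p. 415: *"There is at least one
internal line"*) is the sub-chain on the vertices `a, …, b` (`a < b ≤ nL`) with the lines between them: `ChainData.sub`, again a
chain.

WHAT THIS MODULE PROVES (sorry-free; `def`s with bodies: `ChainData` (+ `rIdx`, `lIdx`, `otherAux`, `other`, `graph`, `sub`),
`chain24`; no `Prop` fact introduced).  (1) `ChainData.graph` is a graph of the model (lines symmetric, distinct endpoints, ≥ 1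
line) with the incidence of a chain: `intScalar_eq` (vertex `i` has one internal φ′-leg forward if `i < nL` and one backward if
`i > 0`), `intVector_eq` (= 0), `intDiffs_eq`, `sum_intScalar` (`2·nL` internal φ′-legs), `isChainLike_graph`.  (2) Hence, by file 1,
in EVERY dimension d: `nL_sub_one_le_deg` (`D ≥ nL − 1`), `deg_nonneg`, `deg_pos_of_two_le_nL` (two propagators ⇒ `D > 0`), and
**`is24_of_deg_nonpos`**: `D ≤ 0` (n̄ ≥ 1) forces `nL = 1`, both vertices (1.8) with `n + n′ = 1`, `fwd 0 = true`, `fwd 1 = false`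
— the chain IS the graph (2.4), one propagator joining the two differentiated legs — and `D = 0`.  (3) **`sub_pos_or_is24`** =
the printed sentence: every sub-chain of a chain has positive degree or is the graph (2.4) (with degree 0).  (4) The bound is
attained: `chain24` (the graph (2.4) as a chain, vertices (1.8) with `n = 0`, `n′ = 1`) has `D = 0` in every dimension
(`chain24_deg`, by kernel computation of its incidence; cf. `B3Graph24Unique.graph24Tilde_deg`).
NOT here: the analytic half of the sentence (*"the estimate (3.2) for them is a consequence of Proposition 2.1"*), see file 1.
-/

namespace Literature.MathematicalPhysics.QuantumFieldTheory.Balaban1983to89.B3PropagatorChains433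

open Finset B3Prop1 B3Sect2Statements B3VertexBridge B3Cor23Concrete B3DivergentGraphs

variable {nbar : ℕ}

/-! ## The concrete chains of propagators -/

/-- **A chain of propagators**, p. 433 [PDF 23]: `nL ≥ 1` propagators G_k(□, B₀) in a row joining `nL + 1` vertices of the form
(1.8)–(1.11), admissible for the order n̄; `fwd i` records whether the differentiated leg of vertex `i` (leg 0 of (1.8)/(1.9); for
(1.10)/(1.11) the choice only names which φ′-leg points forward) lies on the line to vertex `i + 1`.  Values of `fwd` beyond
`nL` are irrelevant. [cite: Balaban1983Higgs3, p.433] -/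
structure ChainData (nbar : ℕ) where
  /-- number of propagators (lines) of the chain -/
  nL : ℕ
  /-- at least one propagator -/
  nL_pos : 0 < nL
  /-- the vertices `0, …, nL`, of the form (1.8)–(1.11) -/
  kind : Fin (nL + 1) → VertexKind
  /-- the vertices are of the form (1.8)–(1.11) -/
  chain : ∀ i, isChainVertex (kind i) = true
  /-- admissibility for the order n̄ -/
  adm : ∀ i, (kind i).Admissible nbar
  /-- orientation of the φ′-legs of vertex `i`: `true` = leg 0 points to vertex `i + 1` -/
  fwd : ℕ → Bool

namespace ChainData

variable (C : ChainData nbar)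

/-- index of the φ′-leg of vertex `i` pointing forward (to vertex `i + 1`). [cite: Balaban1983Higgs3, p.433] -/
def rIdx (i : ℕ) : ℕ := if C.fwd i then 0 else 1

/-- index of the φ′-leg of vertex `i` pointing backward (to vertex `i − 1`). [cite: Balaban1983Higgs3, p.433] -/
def lIdx (i : ℕ) : ℕ := if C.fwd i then 1 else 0

/-- kernel: every vertex of a chain has two φ′-legs. [cite: Balaban1983Higgs3, (1.8)–(1.11) p.413] -/
theorem scalarLegs_two (i : Fin (C.nL + 1)) : (C.kind i).scalarLegs = 2 := scalarLegs_of_isChainVertex _ (C.chain i)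

/-- kernel: the forward leg index is a leg index. [cite: Balaban1983Higgs3, p.433] -/
theorem rIdx_lt (i : Fin (C.nL + 1)) : C.rIdx i < (C.kind i).scalarLegs := by
  rw [C.scalarLegs_two]; unfold rIdx; split <;> omega

/-- kernel: the backward leg index is a leg index. [cite: Balaban1983Higgs3, p.433] -/
theorem lIdx_lt (i : Fin (C.nL + 1)) : C.lIdx i < (C.kind i).scalarLegs := by
  rw [C.scalarLegs_two]; unfold lIdx; split <;> omega

/-- kernel: the two legs of a vertex are different. [cite: Balaban1983Higgs3, p.433] -/
theorem lIdx_ne_rIdx (i : ℕ) : C.lIdx i ≠ C.rIdx i := by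
  unfold lIdx rIdx; split <;> omega

/-- kernel: a leg index other than the forward one is the backward one. [cite: Balaban1983Higgs3, p.433] -/
theorem eq_lIdx_of_ne_rIdx (i : Fin (C.nL + 1)) (j : Fin (C.kind i).scalarLegs) (h : (j : ℕ) ≠ C.rIdx i) :
    (j : ℕ) = C.lIdx i := by
  have h1 := j.isLt
  have h2 := C.scalarLegs_two i
  revert h
  unfold lIdx rIdx
  cases C.fwd i <;> simp <;> omega

/-- The lines of the chain on φ′-legs given by their indices: the forward leg of vertex `i < nL` is joined to the backward leg of
vertex `i + 1`, the backward leg of vertex `i > 0` to the forward leg of vertex `i − 1`; the backward leg of vertex `0` and the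
forward leg of vertex `nL` are external. [cite: Balaban1983Higgs3, p.433] -/
def otherAux (i : ℕ) (hi : i < C.nL + 1) (j : ℕ) : Option (Leg C.kind) :=
  if j = C.rIdx i then
    (if h : i < C.nL then
      some ⟨⟨i + 1, Nat.succ_lt_succ h⟩, .inl ⟨C.lIdx (i + 1), C.lIdx_lt ⟨i + 1, Nat.succ_lt_succ h⟩⟩⟩ else none)
  else
    (if 0 < i then
      some ⟨⟨i - 1, Nat.lt_of_le_of_lt (Nat.sub_le i 1) hi⟩,
        .inl ⟨C.rIdx (i - 1), C.rIdx_lt ⟨i - 1, Nat.lt_of_le_of_lt (Nat.sub_le i 1) hi⟩⟩⟩ else none)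

/-- The lines of the chain as the map «other endpoint» on all legs (vector legs external). [cite: Balaban1983Higgs3, p.433] -/
def other : Leg C.kind → Option (Leg C.kind)
  | ⟨i, .inl j⟩ => C.otherAux i i.isLt j
  | ⟨_, .inr _⟩ => none

/-- kernel: what the endpoint map of a chain can return on a φ′-leg. [cite: Balaban1983Higgs3, p.433] -/
theorem otherAux_eq_some {i : ℕ} {hi : i < C.nL + 1} {j : ℕ} {z : Leg C.kind} (hz : C.otherAux i hi j = some z) :
    (j = C.rIdx i ∧ ∃ h : i < C.nL, z = ⟨⟨i + 1, Nat.succ_lt_succ h⟩,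
      .inl ⟨C.lIdx (i + 1), C.lIdx_lt ⟨i + 1, Nat.succ_lt_succ h⟩⟩⟩) ∨
    (j ≠ C.rIdx i ∧ ∃ _ : 0 < i, z = ⟨⟨i - 1, Nat.lt_of_le_of_lt (Nat.sub_le i 1) hi⟩,
      .inl ⟨C.rIdx (i - 1), C.rIdx_lt ⟨i - 1, Nat.lt_of_le_of_lt (Nat.sub_le i 1) hi⟩⟩⟩) := by
  unfold otherAux at hz
  by_cases h1 : j = C.rIdx i
  · by_cases h2 : i < C.nL
    · rw [if_pos h1, dif_pos h2] at hz
      exact Or.inl ⟨h1, h2, (Option.some.inj hz).symm⟩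
    · rw [if_pos h1, dif_neg h2] at hz
      exact absurd hz (by simp)
  · by_cases h3 : 0 < i
    · rw [if_neg h1, if_pos h3] at hz
      exact Or.inr ⟨h1, h3, (Option.some.inj hz).symm⟩
    · rw [if_neg h1, if_neg h3] at hz
      exact absurd hz (by simp)

/-- kernel: which φ′-legs of a chain are internal — the forward leg of the vertices `i < nL` and the backward leg of the vertices
`i > 0`. [cite: Balaban1983Higgs3, p.433] -/
theorem isSome_otherAux_iff (i : ℕ) (hi : i < C.nL + 1) (j : ℕ) :
    (C.otherAux i hi j).isSome = true ↔ (j = C.rIdx i ∧ i < C.nL) ∨ (j ≠ C.rIdx i ∧ 0 < i) := by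
  unfold otherAux
  by_cases h1 : j = C.rIdx i <;> by_cases h2 : i < C.nL <;> by_cases h3 : 0 < i <;> simp [h1, h2, h3]

/-- kernel: two φ′-legs with the same vertex and the same index are the same leg (dependent-pair bookkeeping).
[cite: Balaban1983Higgs3, (1.17) p.415] -/
theorem leg_inl_ext {nV : ℕ} {kd : Fin nV → VertexKind} {i i' : Fin nV} (h : i = i') {j : Fin (kd i).scalarLegs}
    {j' : Fin (kd i').scalarLegs} (hj : (j : ℕ) = j') : (⟨i, .inl j⟩ : Leg kd) = ⟨i', .inl j'⟩ := by
  subst h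
  cases Fin.ext hj
  rfl

/-- **The chain as a graph of the model** `B3Cor23Concrete.Graph`: the lines join φ′-legs of consecutive vertices, are
symmetric with distinct endpoints, and there is at least one of them (p. 415). [cite: Balaban1983Higgs3, p.433] -/
def graph : Graph nbar where
  nV := C.nL + 1
  kind := C.kind
  adm := C.adm
  other := C.other
  other_ne := by
    rintro ⟨⟨i, hi⟩, y⟩ z hz
    cases y with
    | inr j => simp [ChainData.other] at hz
    | inl j =>
      have hz0 : C.otherAux i hi j = some z := hz
      rcases C.otherAux_eq_some hz0 with ⟨-, h2, hz'⟩ | ⟨-, h3, hz'⟩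
      · rw [hz']
        intro heq
        have := congrArg (fun w : Leg C.kind => (w.1 : ℕ)) heq
        simp only at this
        omega
      · rw [hz']
        intro heq
        have := congrArg (fun w : Leg C.kind => (w.1 : ℕ)) heq
        simp only at this
        omega
  other_symm := by
    rintro ⟨⟨i, hi⟩, y⟩ z hz
    cases y with
    | inr j => simp [ChainData.other] at hz
    | inl j =>
      have hz0 : C.otherAux i hi j = some z := hz
      rcases C.otherAux_eq_some hz0 with ⟨h1, h2, hz'⟩ | ⟨h1, h3, hz'⟩
      · rw [hz']
        show C.otherAux (i + 1) (Nat.succ_lt_succ h2) (C.lIdx (i + 1)) = some ⟨⟨i, hi⟩, .inl j⟩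
        rw [otherAux, if_neg (C.lIdx_ne_rIdx _), if_pos (by omega : 0 < i + 1)]
        congr 1
        exact leg_inl_ext (Fin.ext (Nat.add_sub_cancel i 1))
          (by show C.rIdx (i + 1 - 1) = (j : ℕ); rw [Nat.add_sub_cancel]; exact h1.symm)
      · rw [hz']
        show C.otherAux (i - 1) (Nat.lt_of_le_of_lt (Nat.sub_le i 1) hi) (C.rIdx (i - 1)) = some ⟨⟨i, hi⟩, .inl j⟩
        have hi1 : i - 1 + 1 = i := by omega
        rw [otherAux, if_pos rfl, dif_pos (by omega : i - 1 < C.nL)]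
        congr 1
        exact leg_inl_ext (Fin.ext hi1)
          (by show C.lIdx (i - 1 + 1) = (j : ℕ); rw [hi1]; exact (C.eq_lIdx_of_ne_rIdx ⟨i, hi⟩ j h1).symm)
  other_isLeft := by
    rintro ⟨⟨i, hi⟩, y⟩ z hz
    cases y with
    | inr j => simp [ChainData.other] at hz
    | inl j =>
      have hz0 : C.otherAux i hi j = some z := hz
      rcases C.otherAux_eq_some hz0 with ⟨-, h2, hz'⟩ | ⟨-, h3, hz'⟩ <;> rw [hz'] <;> rfl
  exists_line := ⟨⟨⟨0, Nat.succ_pos _⟩, .inl ⟨C.rIdx 0, C.rIdx_lt ⟨0, Nat.succ_pos _⟩⟩⟩, by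
    show (C.otherAux 0 (Nat.succ_pos _) (C.rIdx 0)).isSome = true
    rw [otherAux, if_pos rfl, dif_pos C.nL_pos]
    rfl⟩

/-- kernel: the graph of a chain has `nL + 1` vertices. [cite: Balaban1983Higgs3, p.433] -/
theorem graph_nV : C.graph.nV = C.nL + 1 := rfl

/-- kernel: counting over the two φ′-legs of a vertex. [cite: Balaban1983Higgs3, (1.8)–(1.11) p.413] -/
theorem card_filter_fin_two {s : ℕ} (hs : s = 2) (P : ℕ → Prop) [DecidablePred P] :
    (univ.filter fun j : Fin s => P j).card = (if P 0 then 1 else 0) + (if P 1 then 1 else 0) := by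
  subst hs
  rw [Finset.card_filter, Fin.sum_univ_two]
  rfl

/-- kernel: the number of internal φ′-legs of vertex `i` of a chain: one forward if `i < nL`, one backward if `i > 0`.
[cite: Balaban1983Higgs3, (2.1) p.422] -/
theorem intScalar_eq (i : Fin (C.nL + 1)) :
    C.graph.intScalar i = (if (i : ℕ) < C.nL then 1 else 0) + (if 0 < (i : ℕ) then 1 else 0) := by
  unfold Graph.intScalar
  change (univ.filter fun j : Fin (C.kind i).scalarLegs => (C.otherAux i i.isLt j).isSome).card = _
  simp_rw [C.isSome_otherAux_iff]
  refine (card_filter_fin_two (C.scalarLegs_two i)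
    (fun v => (v = C.rIdx i ∧ (i : ℕ) < C.nL) ∨ (v ≠ C.rIdx i ∧ 0 < (i : ℕ)))).trans ?_
  unfold rIdx
  by_cases ha : (i : ℕ) < C.nL <;> by_cases hb : 0 < (i : ℕ) <;> cases C.fwd i <;> simp [ha, hb]

/-- kernel: every vector leg of a chain is external. [cite: Balaban1983Higgs3, p.433] -/
theorem intVector_eq (i : Fin (C.nL + 1)) : C.graph.intVector i = 0 := by
  unfold Graph.intVector
  rw [Finset.card_eq_zero, Finset.filter_eq_empty_iff]
  intro j _
  change ¬ (C.other ⟨i, .inr j⟩).isSome = true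
  simp [ChainData.other]

/-- kernel: the differentiation of vertex `i` acts on an internal line iff its leg 0 is internal: forward-pointing with
`i < nL`, or backward-pointing with `i > 0`. [cite: Balaban1983Higgs3, (2.1) p.422] -/
theorem intDiffs_eq (i : Fin (C.nL + 1)) :
    C.graph.intDiffs i =
      if (C.fwd i = true ∧ (i : ℕ) < C.nL) ∨ (C.fwd i = false ∧ 0 < (i : ℕ)) then (C.kind i).diffCount else 0 := by
  have h0 : 0 < (C.kind i).scalarLegs := by rw [C.scalarLegs_two]; omega
  change (if h : 0 < (C.kind i).scalarLegs then
      (if (C.otherAux i i.isLt 0).isSome then (C.kind i).diffCount else 0) else 0) = _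
  rw [dif_pos h0]
  have key : (C.otherAux i i.isLt 0).isSome = true ↔
      ((C.fwd i = true ∧ (i : ℕ) < C.nL) ∨ (C.fwd i = false ∧ 0 < (i : ℕ))) := by
    rw [C.isSome_otherAux_iff]
    unfold rIdx
    cases C.fwd i <;> simp
  by_cases hc : (C.fwd i = true ∧ (i : ℕ) < C.nL) ∨ (C.fwd i = false ∧ 0 < (i : ℕ))
  · rw [if_pos (key.mpr hc), if_pos hc]
  · rw [if_neg (fun h => hc (key.mp h)), if_neg hc]

/-- kernel: a chain with `nL` lines has `2·nL = 2·(nL + 1) − 2` internal φ′-legs. [cite: Balaban1983Higgs3, p.433] -/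
theorem sum_intScalar : ∑ i, C.graph.intScalar i + 2 = 2 * C.graph.nV := by
  change ∑ i : Fin (C.nL + 1), C.graph.intScalar i + 2 = 2 * (C.nL + 1)
  rw [Finset.sum_congr rfl fun i _ => C.intScalar_eq i, Finset.sum_add_distrib]
  have h1 : ∑ i : Fin (C.nL + 1), (if (i : ℕ) < C.nL then 1 else 0) = C.nL := by
    rw [Fin.sum_univ_castSucc]
    simp
  have h2 : ∑ i : Fin (C.nL + 1), (if 0 < (i : ℕ) then 1 else 0) = C.nL := by
    rw [Fin.sum_univ_succ]
    simp
  omega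

/-- **The concrete chains have the incidence of a chain.** [cite: Balaban1983Higgs3, p.433] -/
theorem isChainLike_graph : IsChainLike C.graph where
  kind_chain := C.chain
  intVector_zero := C.intVector_eq
  sum_intScalar := C.sum_intScalar

/-- **p. 433 for the concrete chains**, every dimension d: `D(chain) ≥ nL − 1 ≥ 0` (`nL + 1` vertices).
[cite: Balaban1983Higgs3, p.433] -/
theorem nL_sub_one_le_deg (d : ℕ) : (C.nL : ℚ) - 1 ≤ C.graph.deg d := by
  have h := C.isChainLike_graph.nV_sub_two_le_deg d
  rw [graph_nV] at h
  push_cast at h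
  linarith

/-- **p. 433 for the concrete chains**: `D(chain) ≥ 0` in every dimension. [cite: Balaban1983Higgs3, p.433] -/
theorem deg_nonneg (d : ℕ) : 0 ≤ C.graph.deg d := C.isChainLike_graph.deg_nonneg d

/-- **p. 433 for the concrete chains**: a chain with at least two propagators has POSITIVE degree, every dimension.
[cite: Balaban1983Higgs3, p.433] -/
theorem deg_pos_of_two_le_nL (d : ℕ) (h2 : 2 ≤ C.nL) : 0 < C.graph.deg d :=
  C.isChainLike_graph.deg_pos_of_three_le_nV d (by rw [graph_nV]; omega)

/-- **p. 433** [PDF 23], verbatim: *"For such chains, every subgraph has positive degree or contains (2.4)"* — for the concrete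
chains (n̄ ≥ 1, every dimension d): `D(chain) ≤ 0` forces the chain to BE the graph (2.4) — one propagator, both vertices of the
form (1.8) with `n + n′ = 1`, the differentiated leg of vertex 0 pointing forward and that of vertex 1 backward (the line joins
the two differentiated legs), and `D = 0`. [cite: Balaban1983Higgs3, p.433] -/
theorem is24_of_deg_nonpos (hn : 1 ≤ nbar) (d : ℕ) (hD : C.graph.deg d ≤ 0) :
    C.nL = 1 ∧ (∀ i, ∃ n n' : ℕ, C.kind i = .v18 n n' ∧ n + n' = 1) ∧ C.fwd 0 = true ∧ C.fwd 1 = false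
      ∧ C.graph.deg d = 0 := by
  obtain ⟨hV, hkind, hinc, hdeg⟩ := C.isChainLike_graph.shape24_of_deg_nonpos hn d hD
  have hL : C.nL = 1 := by have := C.graph_nV; omega
  have hkind' : ∀ i : Fin (C.nL + 1), ∃ n n' : ℕ, C.kind i = .v18 n n' ∧ n + n' = 1 := fun i => hkind i
  have hdc : ∀ i : Fin (C.nL + 1), (C.kind i).diffCount = 1 := fun i => by
    obtain ⟨n, n', hk, -⟩ := hkind' i
    rw [hk]; rfl
  have h0 := (hinc (⟨0, by omega⟩ : Fin (C.nL + 1))).2.2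
  have h1 := (hinc (⟨1, by omega⟩ : Fin (C.nL + 1))).2.2
  rw [C.intDiffs_eq] at h0 h1
  simp [hdc, hL] at h0 h1
  exact ⟨hL, hkind', by simpa using h0, by simpa using h1, hdeg⟩

/-! ### Sub-chains -/

/-- A SUBGRAPH of a chain (connected, at least one line) is the sub-chain on the vertices `a, a+1, …, b`, `a < b ≤ nL`, with the
lines between them — again a chain (p. 433: *"every subgraph"*). [cite: Balaban1983Higgs3, p.433] -/
def sub (a b : ℕ) (hab : a < b) (hb : b ≤ C.nL) : ChainData nbar where
  nL := b - a
  nL_pos := by omega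
  kind i := C.kind ⟨a + i, by omega⟩
  chain i := C.chain _
  adm i := C.adm _
  fwd i := C.fwd (a + i)

/-- **p. 433** [PDF 23], verbatim: *"For such chains, every subgraph has positive degree or contains (2.4)"* — PROVED on the model
(n̄ ≥ 1, every dimension d): every sub-chain of a chain of propagators has positive degree, unless it is the graph (2.4) itself
(one propagator joining the differentiated legs of two vertices (1.8) with `n + n′ = 1`; degree 0). [cite: Balaban1983Higgs3, p.433] -/
theorem sub_pos_or_is24 (hn : 1 ≤ nbar) (d : ℕ) (a b : ℕ) (hab : a < b) (hb : b ≤ C.nL) :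
    0 < (C.sub a b hab hb).graph.deg d ∨
      (b = a + 1 ∧ (∃ n n' : ℕ, C.kind ⟨a, by omega⟩ = .v18 n n' ∧ n + n' = 1)
        ∧ (∃ n n' : ℕ, C.kind ⟨b, by omega⟩ = .v18 n n' ∧ n + n' = 1) ∧ C.fwd a = true ∧ C.fwd b = false
        ∧ (C.sub a b hab hb).graph.deg d = 0) := by
  by_cases hD : 0 < (C.sub a b hab hb).graph.deg d
  · exact Or.inl hD
  · right
    obtain ⟨hL, hkind, hf0, hf1, hdeg⟩ := (C.sub a b hab hb).is24_of_deg_nonpos hn d (not_lt.mp hD)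
    change b - a = 1 at hL
    have hL' : b = a + 1 := by omega
    subst hL'
    have k0 := hkind ⟨0, by change 0 < a + 1 - a + 1; omega⟩
    have k1 := hkind ⟨1, by change 1 < a + 1 - a + 1; omega⟩
    exact ⟨rfl, k0, k1, hf0, hf1, hdeg⟩

/-! ### The chain (2.4) itself: the bound is attained -/

/-- The graph (2.4) p. 424 as a chain: one propagator joining the differentiated legs of two vertices (1.8) with `n = 0`,
`n′ = 1` (one leg of the external vector field each, as created by the expansion in B′). [cite: Balaban1983Higgs3, (2.4) p.424] -/
def chain24 (nbar : ℕ) (hn : 1 ≤ nbar) : ChainData nbar where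
  nL := 1
  nL_pos := Nat.one_pos
  kind _ := .v18 0 1
  chain _ := rfl
  adm _ := by simp [VertexKind.Admissible, hn]
  fwd i := decide (i = 0)

/-- kernel: the chain (2.4) has degree 0 in every dimension (compare `B3Graph24Unique.graph24Tilde_deg`) — the case of equality
in `deg_nonneg`. [cite: Balaban1983Higgs3, (2.4) p.424] -/
theorem chain24_deg (hn : 1 ≤ nbar) (d : ℕ) : (chain24 nbar hn).graph.deg d = 0 := by
  have a0 : (chain24 nbar hn).graph.intScalar (0 : Fin 2) = 1 := by rfl
  have a1 : (chain24 nbar hn).graph.intScalar (1 : Fin 2) = 1 := by rfl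
  have b0 : (chain24 nbar hn).graph.intVector (0 : Fin 2) = 0 := by rfl
  have b1 : (chain24 nbar hn).graph.intVector (1 : Fin 2) = 0 := by rfl
  have c0 : (chain24 nbar hn).graph.intDiffs (0 : Fin 2) = 1 := by rfl
  have c1 : (chain24 nbar hn).graph.intDiffs (1 : Fin 2) = 1 := by rfl
  rw [Graph.deg_eq]
  change (∑ i : Fin 2, (chain24 nbar hn).graph.vertexDeg d i) - (d : ℚ) = 0
  rw [Fin.sum_univ_two, Graph.vertexDeg_eq, Graph.vertexDeg_eq, a0, a1, b0, b1, c0, c1]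
  simp [chain24, ChainData.graph, VertexKind.etaCount, VertexKind.isAveragingVertex]
  ring

end ChainData

end Literature.MathematicalPhysics.QuantumFieldTheory.Balaban1983to89.B3PropagatorChains433
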